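import Literature.Probability.Percolation.ShieldedPairWeights
import Literature.Probability.Percolation.FiniteClustersPercolation
import Literature.Probability.Percolation.CriticalContinuityProofs
import Literature.Probability.Percolation.SecondMomentMethod
import HarnessLib

/-!
# Shielded oriented paths percolate: the second-moment step of BDNS Theorem 1.2

Topic `Literature/Probability/Percolation`.  Sorry-free, no named facts.  This file carries out the
probabilistic part of the proof of Theorem 1.2 of Bock–Damron–Newman–Sidoravicius, *Percolation
of finite clusters and shielded paths*, J. Stat. Phys. 179 (2020), §3 (pp. 5–7), on top of the
combinatorics of `ShieldedOrientedPaths.lean` ((3.2), (3.4)) and the weight bound of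
`ShieldedPairWeights.lean` (Lemma 3.1):

* `adjClosed w` = "all edges adjacent to the oriented path of `w` are closed" (`γ` is shielded),
  `P_p(adjClosed w) = q^{2d + n(2d-1)}` (`real_adjClosed`, (3.2)), and by (3.4)
  `P_p(adjClosed w ∩ adjClosed w') q^{2d + (2d-1)#Z + #O} ≤ q^{2(2d + n(2d-1))}`
  (`real_adjClosed_inter_mul_le`, (3.3)–(3.4));
* `real_someShielded_ge`: the Chung–Erdős / Paley–Zygmund bound of `SecondMomentMethod.lean`
  gives `P_p(N_n ≥ 1) ≥ (E N_n)²/E N_n² ≥ q^{2d} / phiW d α β n 0` with `α = q^{-(2d-1)}`,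
  `β = q^{-1}` ((3.9)–(3.10));
* `iInter_someShielded_subset_shieldedPathsPercolate`: if shielded oriented paths of every length
  leave the origin, there is an infinite shielded path (König's lemma on the `d`-ary tree of oriented
  words, "there will be an infinite (oriented) shielded path with positive probability", p. 5);
* **`le_pShield_of_phiW_le`**: if `phiW d α β n 0 ≤ V₀ < ∞` for all `n`, then
  `P_p(∃ an infinite shielded path) ≥ q^{2d}/V₀ > 0`, hence `p ≤ p_shield(d)` ((3.10), (3.15)).

## References

* B. Bock, M. Damron, C. M. Newman, V. Sidoravicius, J. Stat. Phys. 179 (2020) 789–807,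
  arXiv:1811.01678, §3, (3.1)–(3.15). [BockEtAl2020]
* R. Lyons, Y. Peres, *Probability on Trees and Networks*, CUP 2016, §5.3 (second moment).
-/

noncomputable section

namespace Literature.Probability.Percolation

open MeasureTheory Finset Literature.Probability.LatticeModels
open scoped ENNReal

variable {d n : ℕ}

/-! ### Restricting and shifting oriented words -/

/-- Restricting a word to its first `m` letters does not change the first `m` positions. [folklore] -/
theorem opos_castLE {m : ℕ} (h : m ≤ n) (w : Fin n → Fin d) {k : ℕ} (hk : k ≤ m) :
    opos (fun i : Fin m => w (Fin.castLE h i)) k = opos w k := by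
  induction k with
  | zero => simp
  | succ k ih =>
    rw [opos_succ _ hk, opos_succ w (by omega), ih (by omega)]
    rfl

/-- Positions of a word in terms of its tail. [folklore] -/
theorem opos_tail (w : Fin (n + 1) → Fin d) (k : ℕ) :
    opos w (k + 1) = Pi.single (w 0) 1 + opos (Fin.tail w) k := by
  conv_lhs => rw [← Fin.cons_self_tail w]
  exact opos_cons_succ _ _ _

/-- Dropping the last letter shrinks the set of adjacent edges (piecewise). [folklore] -/
theorem adjPiece_init_subset (w : Fin (n + 1) → Fin d) {t : ℕ} (ht : t ≤ n + 1) :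
    adjPiece (Fin.init w) t ⊆ adjPiece w t := by
  unfold adjPiece
  by_cases ht0 : t = 0
  · simp [ht0]
  · rw [if_neg ht0, if_neg ht0]
    by_cases ht1 : t ≤ n
    · rw [if_pos ht1, if_pos (by omega), layer, layer, opos_init w (by omega),
        opos_init w (by omega)]
    · have : t = n + 1 := by omega
      subst this
      rw [if_neg ht1, if_pos le_rfl, layer, opos_init w le_rfl, Nat.add_sub_cancel]
      exact Finset.subset_union_left

/-- Dropping the last letter shrinks the set of adjacent edges. [folklore] -/
theorem adjEdges_init_subset (w : Fin (n + 1) → Fin d) : adjEdges (Fin.init w) ⊆ adjEdges w := by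
  intro e he
  rw [adjEdges, Finset.mem_biUnion] at he ⊢
  obtain ⟨t, ht, he⟩ := he
  rw [Finset.mem_range] at ht
  exact ⟨t, Finset.mem_range.2 (by omega), adjPiece_init_subset w (by omega) he⟩

/-! ### The events "`γ` is shielded" and their probabilities -/

/-- The event "every lattice edge with an endpoint on the oriented path of `w` is closed" (all
vertices of `γ` are shielded). [cite: BockEtAl2020, §3 (proof of Thm 1.2)] -/
def adjClosed (w : Fin n → Fin d) : Set (BondConfig (Site d)) :=
  {ω | Disjoint (↑(adjEdges w) : Set (Sym2 (Site d))) ω}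

/-- `adjClosed w` is a (finite-dimensional cylinder, hence) measurable event. [folklore] -/
theorem measurableSet_adjClosed (w : Fin n → Fin d) : MeasurableSet (adjClosed w) := by
  have : adjClosed w = ⋂ e ∈ adjEdges w, {ω : BondConfig (Site d) | e ∈ ω}ᶜ := by
    ext ω
    simp [adjClosed, Set.disjoint_left]
  rw [this]
  exact MeasurableSet.biInter (Finset.countable_toSet _) fun e _ => (measurableSet_mem e).compl

/-- **BDNS (3.2)**: `P_p(γ shielded) = q^{2d + n(2d-1)}`. [cite: BockEtAl2020, §3 (3.2)] -/
theorem real_adjClosed (p : unitInterval) (w : Fin n → Fin d) :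
    (bondPercolation (zdGraph d) p).real (adjClosed w) = (1 - p : ℝ) ^ (2 * d + n * (2 * d - 1)) := by
  rw [adjClosed, bondPercolation_real_setOf_disjoint _ p _ (adjEdges_subset_edgeSet w), card_adjEdges]

/-- The intersection of two such events is the cylinder of the union of the edge sets. [folklore] -/
theorem adjClosed_inter (w w' : Fin n → Fin d) :
    adjClosed w ∩ adjClosed w' =
      {ω | Disjoint (↑(adjEdges w ∪ adjEdges w') : Set (Sym2 (Site d))) ω} := by
  ext ω
  simp only [adjClosed, Set.mem_inter_iff, Set.mem_setOf_eq, Finset.coe_union,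
    Set.disjoint_union_left]

/-- `P_p(γ, γ' shielded) = q^{#(𝓔(γ) ∪ 𝓔(γ'))}`. [cite: BockEtAl2020, §3 (3.3)] -/
theorem real_adjClosed_inter (p : unitInterval) (w w' : Fin n → Fin d) :
    (bondPercolation (zdGraph d) p).real (adjClosed w ∩ adjClosed w') =
      (1 - p : ℝ) ^ (adjEdges w ∪ adjEdges w').card := by
  rw [adjClosed_inter, bondPercolation_real_setOf_disjoint _ p _ ?_]
  rw [Finset.coe_union, Set.union_subset_iff]
  exact ⟨adjEdges_subset_edgeSet w, adjEdges_subset_edgeSet w'⟩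

/-- **BDNS (3.3)–(3.4)**: `P_p(γ, γ' shielded) · q^{2d + (2d-1)#Z + #O} ≤ q^{2(2d + n(2d-1))}`.
[cite: BockEtAl2020, §3 (3.3)–(3.4)] -/
theorem real_adjClosed_inter_mul_le (p : unitInterval) (w w' : Fin n → Fin d) :
    (bondPercolation (zdGraph d) p).real (adjClosed w ∩ adjClosed w') *
        (1 - p : ℝ) ^ (2 * d + (2 * d - 1) * zCount w w' + oCount w w') ≤
      ((1 - p : ℝ) ^ (2 * d + n * (2 * d - 1))) ^ 2 := by
  rw [real_adjClosed_inter, ← pow_add]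
  have hq0 : (0 : ℝ) ≤ 1 - p := sub_nonneg.2 p.2.2
  have hq1 : (1 : ℝ) - p ≤ 1 := sub_le_self _ p.2.1
  have hcard : (adjEdges w ∪ adjEdges w').card + (adjEdges w ∩ adjEdges w').card =
      2 * (2 * d + n * (2 * d - 1)) := by
    rw [Finset.card_union_add_card_inter, card_adjEdges, card_adjEdges]
    ring
  have hle := card_adjEdges_inter_le w w'
  calc (1 - p : ℝ) ^ ((adjEdges w ∪ adjEdges w').card + (2 * d + (2 * d - 1) * zCount w w' + oCount w w'))
      ≤ (1 - p : ℝ) ^ ((adjEdges w ∪ adjEdges w').card + (adjEdges w ∩ adjEdges w').card) :=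
        pow_le_pow_of_le_one hq0 hq1 (by omega)
    _ = ((1 - p : ℝ) ^ (2 * d + n * (2 * d - 1))) ^ 2 := by
        rw [hcard, pow_mul']

/-- The event "`N_n ≥ 1`": some oriented path of length `n` from the origin is shielded.
[cite: BockEtAl2020, §3 (`N_n`)] -/
def someShielded (d n : ℕ) : Set (BondConfig (Site d)) :=
  ⋃ w : Fin n → Fin d, adjClosed w

/-- `{N_n ≥ 1}` is measurable. [folklore] -/
theorem measurableSet_someShielded (d n : ℕ) : MeasurableSet (someShielded d n) :=
  MeasurableSet.iUnion fun w => measurableSet_adjClosed w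

/-- `{N_n ≥ 1}` decreases in `n`. [cite: BockEtAl2020, §3] -/
theorem someShielded_antitone (d : ℕ) : Antitone (someShielded d) := by
  refine antitone_nat_of_succ_le fun n ω hω => ?_
  obtain ⟨w, hw⟩ := Set.mem_iUnion.1 hω
  refine Set.mem_iUnion.2 ⟨Fin.init w, ?_⟩
  exact Set.disjoint_of_subset_left (Finset.coe_subset.2 (adjEdges_init_subset w)) hw

/-! ### The second-moment bound (3.10) -/

/-- `q^{-(2m + (2m-1)Z + O)} = q^{-2m} (q^{-(2m-1)})^Z (q^{-1})^O`. [folklore] -/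
theorem inv_pow_weights (q : ℝ) {m Z O : ℕ} :
    (q ^ (2 * m + (2 * m - 1) * Z + O))⁻¹ = (q ^ (2 * m))⁻¹ * ((q⁻¹ ^ (2 * m - 1)) ^ Z * (q⁻¹) ^ O) := by
  rw [pow_add, pow_add, mul_inv, mul_inv, inv_pow, inv_pow, inv_pow, ← pow_mul, mul_assoc]


/-- **BDNS (3.9)–(3.10)**: `P_p(N_n ≥ 1) ≥ q^{2d} / V₀` whenever `phiW d q^{-(2d-1)} q^{-1} n 0 ≤ V₀`.
[cite: BockEtAl2020, §3 (3.9)–(3.10)] -/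
theorem real_someShielded_ge (hd : 1 ≤ d) (p : unitInterval) (hp1 : (p : ℝ) < 1) {V0 : ℝ}
    (hV0 : 0 < V0) (n : ℕ)
    (hphi : phiW d ((1 - p : ℝ)⁻¹ ^ (2 * d - 1)) ((1 - p : ℝ)⁻¹) n 0 ≤ V0) :
    (1 - p : ℝ) ^ (2 * d) / V0 ≤ (bondPercolation (zdGraph d) p).real (someShielded d n) := by
  haveI : Nonempty (Fin d) := ⟨⟨0, hd⟩⟩
  set μ := bondPercolation (zdGraph d) p with hμ
  set q : ℝ := 1 - p with hq
  have hq0 : 0 < q := sub_pos.2 hp1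
  set A : ℕ := 2 * d + n * (2 * d - 1) with hA
  -- Chung–Erdős
  have key := sq_sum_measureReal_le_measureReal_biUnion_mul_sum μ (univ : Finset (Fin n → Fin d))
    adjClosed (fun w _ => measurableSet_adjClosed w)
  have hU : (⋃ w ∈ (univ : Finset (Fin n → Fin d)), adjClosed w) = someShielded d n := by
    simp [someShielded]
  rw [hU] at key
  -- the first moment
  have hnum : ∑ w ∈ (univ : Finset (Fin n → Fin d)), μ.real (adjClosed w) = (d : ℝ) ^ n * q ^ A := by
    simp only [hμ, real_adjClosed, Finset.sum_const, Finset.card_univ, Fintype.card_fun,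
      Fintype.card_fin, nsmul_eq_mul]
    push_cast
    ring
  -- the second moment
  have hden : ∑ w ∈ (univ : Finset (Fin n → Fin d)), ∑ w' ∈ (univ : Finset (Fin n → Fin d)),
      μ.real (adjClosed w ∩ adjClosed w') ≤
      (q ^ A) ^ 2 * (q ^ (2 * d))⁻¹ * ((d : ℝ) ^ (2 * n) * V0) := by
    have hterm : ∀ w w' : Fin n → Fin d, μ.real (adjClosed w ∩ adjClosed w') ≤
        (q ^ A) ^ 2 * (q ^ (2 * d))⁻¹ *
          ((q⁻¹ ^ (2 * d - 1)) ^ zCount w w' * (q⁻¹) ^ oCount w w') := by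
      intro w w'
      have h := real_adjClosed_inter_mul_le p w w'
      rw [← hμ, ← hq, ← hA] at h
      have hpos : 0 < q ^ (2 * d + (2 * d - 1) * zCount w w' + oCount w w') := pow_pos hq0 _
      rw [← le_div_iff₀ hpos] at h
      refine h.trans (le_of_eq ?_)
      rw [div_eq_mul_inv, inv_pow_weights q, mul_assoc]
    calc ∑ w ∈ (univ : Finset (Fin n → Fin d)), ∑ w' ∈ (univ : Finset (Fin n → Fin d)),
          μ.real (adjClosed w ∩ adjClosed w')
        ≤ ∑ w ∈ (univ : Finset (Fin n → Fin d)), ∑ w' ∈ (univ : Finset (Fin n → Fin d)),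
            (q ^ A) ^ 2 * (q ^ (2 * d))⁻¹ *
              ((q⁻¹ ^ (2 * d - 1)) ^ zCount w w' * (q⁻¹) ^ oCount w w') :=
          Finset.sum_le_sum fun w _ => Finset.sum_le_sum fun w' _ => hterm w w'
      _ = (q ^ A) ^ 2 * (q ^ (2 * d))⁻¹ *
            ((d : ℝ) ^ (2 * n) * phiW d (q⁻¹ ^ (2 * d - 1)) q⁻¹ n 0) := by
          rw [← sum_pow_zCount_mul_pow_oCount hd, Finset.mul_sum]
          refine Finset.sum_congr rfl fun w _ => ?_
          rw [Finset.mul_sum]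
      _ ≤ (q ^ A) ^ 2 * (q ^ (2 * d))⁻¹ * ((d : ℝ) ^ (2 * n) * V0) := by
          refine mul_le_mul_of_nonneg_left (mul_le_mul_of_nonneg_left hphi (by positivity)) ?_
          positivity
  rw [hnum] at key
  have hden_pos : 0 < (q ^ A) ^ 2 * (q ^ (2 * d))⁻¹ * ((d : ℝ) ^ (2 * n) * V0) := by positivity
  have h2 : ((d : ℝ) ^ n * q ^ A) ^ 2 ≤
      μ.real (someShielded d n) * ((q ^ A) ^ 2 * (q ^ (2 * d))⁻¹ * ((d : ℝ) ^ (2 * n) * V0)) :=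
    key.trans (mul_le_mul_of_nonneg_left hden measureReal_nonneg)
  rw [div_le_iff₀ hV0]
  have hd0 : (0 : ℝ) < d := by exact_mod_cast hd
  have hq2d : 0 < q ^ (2 * d) := pow_pos hq0 _
  have hqA : 0 < q ^ A := pow_pos hq0 _
  -- divide `h2` by the positive quantity `(q^A)^2 (q^{2d})⁻¹ d^{2n}`
  have h3 : ((d : ℝ) ^ n * q ^ A) ^ 2 = q ^ (2 * d) * ((q ^ A) ^ 2 * (q ^ (2 * d))⁻¹ * (d : ℝ) ^ (2 * n)) := by
    field_simp
    ring
  rw [h3] at h2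
  have h4 : μ.real (someShielded d n) * ((q ^ A) ^ 2 * (q ^ (2 * d))⁻¹ * ((d : ℝ) ^ (2 * n) * V0)) =
      (μ.real (someShielded d n) * V0) * ((q ^ A) ^ 2 * (q ^ (2 * d))⁻¹ * (d : ℝ) ^ (2 * n)) := by
    ring
  rw [h4] at h2
  exact le_of_mul_le_mul_right h2 (by positivity)

/-! ### König's lemma: from arbitrarily long shielded paths to an infinite one -/

/-- All vertices of the oriented path of `w` started at `x` are shielded. [cite: BockEtAl2020, §1.1] -/
def ShieldedWord (ω : BondConfig (Site d)) (x : Site d) {m : ℕ} (w : Fin m → Fin d) : Prop :=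
  ∀ k ≤ m, IsShielded (zdGraph d) ω (x + opos w k)

/-- Shielded oriented paths of every length leave `x`. [cite: BockEtAl2020, §3 (proof of Thm 1.2)] -/
def ShieldedGood (ω : BondConfig (Site d)) (x : Site d) : Prop :=
  ∀ m : ℕ, ∃ w : Fin m → Fin d, ShieldedWord ω x w

/-- A good vertex is shielded. [folklore] -/
theorem ShieldedGood.shielded {ω : BondConfig (Site d)} {x : Site d} (h : ShieldedGood ω x) :
    IsShielded (zdGraph d) ω x := by
  obtain ⟨w, hw⟩ := h 0
  simpa using hw 0 le_rfl

/-- Prefixes of good words are good. [folklore] -/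
theorem ShieldedWord.castLE {ω : BondConfig (Site d)} {x : Site d} {m : ℕ} (h : m ≤ n)
    {w : Fin n → Fin d} (hw : ShieldedWord ω x w) :
    ShieldedWord ω x (fun i : Fin m => w (Fin.castLE h i)) := fun k hk => by
  rw [opos_castLE h w hk]
  exact hw k (by omega)

/-- Tails of good words are good from the next vertex. [folklore] -/
theorem ShieldedWord.tail {ω : BondConfig (Site d)} {x : Site d} {w : Fin (n + 1) → Fin d}
    (hw : ShieldedWord ω x w) : ShieldedWord ω (x + Pi.single (w 0) 1) (Fin.tail w) := fun k hk => by
  rw [add_assoc, ← opos_tail]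
  exact hw (k + 1) (by omega)

/-- **The König step**: a good vertex has a good out-neighbour (finitely many directions; if every
`x + e_a` failed at some length `N_a`, no word of length `max_a N_a + 1` from `x` would be good).
[folklore] -/
theorem ShieldedGood.exists_succ {ω : BondConfig (Site d)} {x : Site d} (h : ShieldedGood ω x) :
    ∃ a : Fin d, ShieldedGood ω (x + Pi.single a 1) := by
  by_contra hcon
  simp only [not_exists, ShieldedGood, not_forall] at hcon
  choose N hN using hcon
  obtain ⟨w, hw⟩ := h ((univ : Finset (Fin d)).sup N + 1)
  have hM : N (w 0) ≤ (univ : Finset (Fin d)).sup N := Finset.le_sup (Finset.mem_univ _)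
  exact hN (w 0) _ (hw.tail.castLE hM)

/-- **König's lemma for shielded oriented paths**: if shielded oriented paths of every length leave
the origin, there is an infinite (self-avoiding) shielded path. [cite: BockEtAl2020, §3 (proof of Thm 1.2)] -/
theorem mem_shieldedPathsPercolate_of_good {ω : BondConfig (Site d)} (h : ShieldedGood ω 0) :
    ω ∈ shieldedPathsPercolate (zdGraph d) := by
  have step : ∀ x : {x : Site d // ShieldedGood ω x}, ∃ y : {x : Site d // ShieldedGood ω x}, ∃ a : Fin d,
      y.1 = x.1 + Pi.single a 1 := fun x => by
    obtain ⟨a, ha⟩ := x.2.exists_succ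
    exact ⟨⟨_, ha⟩, a, rfl⟩
  choose f hf using step
  set γ : ℕ → {x : Site d // ShieldedGood ω x} := fun m => f^[m] ⟨0, h⟩ with hγ
  have hγs : ∀ m, γ (m + 1) = f (γ m) := fun m => Function.iterate_succ_apply' f m _
  have hlev : ∀ m, level (γ m).1 = m := by
    intro m
    induction m with
    | zero => simp [hγ]
    | succ m ih =>
      obtain ⟨a, ha⟩ := hf (γ m)
      rw [hγs, ha, level_add_single, ih]
      push_cast
      ring
  refine ⟨fun m => (γ m).1, ?_, ?_, ?_⟩
  · intro m m' hmm
    have := congrArg level hmm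
    simp only [hlev] at this
    exact_mod_cast this
  · intro m
    obtain ⟨a, ha⟩ := hf (γ m)
    show (zdGraph d).Adj (γ m).1 (γ (m + 1)).1
    rw [hγs, ha]
    exact (zdGraph_adj_iff _ _).2 ⟨a, Or.inl rfl⟩
  · intro m
    exact (γ m).2.shielded

/-- Shielded oriented paths of all lengths from the origin give an infinite shielded path.
[cite: BockEtAl2020, §3 (proof of Thm 1.2)] -/
theorem iInter_someShielded_subset (d : ℕ) :
    (⋂ n, someShielded d n) ⊆ shieldedPathsPercolate (zdGraph d) := by
  intro ω hω
  simp only [Set.mem_iInter, someShielded, Set.mem_iUnion] at hω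
  refine mem_shieldedPathsPercolate_of_good fun m => ?_
  obtain ⟨w, hw⟩ := hω m
  refine ⟨w, fun k hk y hy => ?_⟩
  rw [zero_add] at hy ⊢
  exact Set.disjoint_left.1 hw (Finset.mem_coe.2 (mem_adjEdges_of_adj w hk hy))

/-! ### Conclusion: `p ≤ p_shield` -/

/-- **BDNS (3.10)/(3.15)**: if `phiW d q^{-(2d-1)} q^{-1} n 0 ≤ V₀` for all `n` (the finite-horizon
form of `E q^{-#O-(2d-1)#Z} < ∞`), then `P_p(∃ an infinite shielded path) ≥ q^{2d}/V₀`.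
[cite: BockEtAl2020, §3 (3.10), (3.15)] -/
theorem real_shieldedPathsPercolate_ge (hd : 1 ≤ d) (p : unitInterval) (hp1 : (p : ℝ) < 1)
    {V0 : ℝ} (hV0 : 0 < V0)
    (hphi : ∀ n, phiW d ((1 - p : ℝ)⁻¹ ^ (2 * d - 1)) ((1 - p : ℝ)⁻¹) n 0 ≤ V0) :
    (1 - p : ℝ) ^ (2 * d) / V0 ≤
      (bondPercolation (zdGraph d) p).real (shieldedPathsPercolate (zdGraph d)) := by
  set μ := bondPercolation (zdGraph d) p with hμ
  have h1 : μ (⋂ n, someShielded d n) = ⨅ n, μ (someShielded d n) :=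
    (someShielded_antitone d).measure_iInter
      (fun n => (measurableSet_someShielded d n).nullMeasurableSet) ⟨0, measure_ne_top _ _⟩
  have h2 : ENNReal.ofReal ((1 - p : ℝ) ^ (2 * d) / V0) ≤ μ (⋂ n, someShielded d n) := by
    rw [h1]
    refine le_iInf fun n => ?_
    rw [← ENNReal.ofReal_toReal (measure_ne_top μ (someShielded d n))]
    exact ENNReal.ofReal_le_ofReal (real_someShielded_ge hd p hp1 hV0 n (hphi n))
  have h3 : μ (⋂ n, someShielded d n) ≤ μ (shieldedPathsPercolate (zdGraph d)) :=
    measure_mono (iInter_someShielded_subset d)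
  rw [measureReal_def]
  exact (ENNReal.ofReal_le_iff_le_toReal (measure_ne_top _ _)).1 (h2.trans h3)

/-- A parameter at which infinite shielded paths exist with positive probability is `≤ p_shield`
(a copy of `le_pShield_of_real_pos` of `FiniteClustersPercolationProofs.lean`, which this file must
not import). [cite: BockEtAl2020, (1.3)] -/
private theorem le_pShield_of_real_pos' {p : unitInterval}
    (hp : 0 < (bondPercolation (zdGraph d) p).real (shieldedPathsPercolate (zdGraph d))) :
    (p : ℝ) ≤ pShield d := by
  refine le_csSup ⟨1, ?_⟩ (Or.inl ⟨p.2, hp⟩)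
  rintro q (⟨hq, -⟩ | hq)
  · exact hq.2
  · rw [Set.mem_singleton_iff] at hq
    rw [hq]
    exact zero_le_one

/-- **BDNS Theorem 1.2, abstract form**: under the same hypothesis, `p ≤ p_shield(d)`.
[cite: BockEtAl2020, Thm 1.2 and §3 (3.15)] -/
theorem le_pShield_of_phiW_le (hd : 1 ≤ d) (p : unitInterval) (hp1 : (p : ℝ) < 1)
    {V0 : ℝ} (hV0 : 0 < V0)
    (hphi : ∀ n, phiW d ((1 - p : ℝ)⁻¹ ^ (2 * d - 1)) ((1 - p : ℝ)⁻¹) n 0 ≤ V0) :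
    (p : ℝ) ≤ pShield d := by
  refine le_pShield_of_real_pos' ((div_pos (pow_pos (sub_pos.2 hp1) (2 * d)) hV0).trans_le ?_)
  exact real_shieldedPathsPercolate_ge hd p hp1 hV0 hphi

/-- The same with the hypotheses of `phiW_zero_le` (Lemma 3.1) spelled out: a bound `r` for the
first-visit probabilities `hS` on `S₂` and a solution `(V_S, V_0)` of the two renewal inequalities.
[cite: BockEtAl2020, Thm 1.2, Lemma 3.1] -/
theorem le_pShield_of_renewal (hd : 1 ≤ d) (p : unitInterval) (hp1 : (p : ℝ) < 1) {r VS V0 : ℝ}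
    (hV0 : 0 < V0)
    (hβ : 1 ≤ (1 - p : ℝ)⁻¹ * VS) (hα : 1 ≤ (1 - p : ℝ)⁻¹ ^ (2 * d - 1) * V0)
    (hr : ∀ (n : ℕ) (z : Site d), IsS2 z → hS d n z ≤ r)
    (h0cond : 1 + (1 - 1 / d) * ((1 - p : ℝ)⁻¹ * VS - 1) +
      (1 / d) * ((1 - p : ℝ)⁻¹ ^ (2 * d - 1) * V0 - 1) ≤ V0)
    (hScond : 1 + r * ((1 - p : ℝ)⁻¹ * VS - 1) +
      (1 / (d : ℝ) ^ 2) * ((1 - p : ℝ)⁻¹ ^ (2 * d - 1) * V0 - 1) ≤ VS) :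
    (p : ℝ) ≤ pShield d := by
  have hq0 : 0 < (1 - p : ℝ) := sub_pos.2 hp1
  exact le_pShield_of_phiW_le hd p hp1 hV0 fun n =>
    phiW_zero_le hd (by positivity) (by positivity) hβ hα hr h0cond hScond n

end Literature.Probability.Percolation

end
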